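import Literature.AlgebraicGeometry.Motives.AffineAlgebraicDeRhamPoincareProofs
import HarnessLib

/-!
# The `𝔸¹`-homotopy operator on polynomial differential forms

Topic `Literature/AlgebraicGeometry/Motives`. Partial progress on the named fact
`Literature.AlgebraicGeometry.Motives.AffineAlgebraicDeRham` [Grothendieck1966, Thm 1]: the
algebraic half of the **`𝔸¹`-homotopy invariance of algebraic de Rham cohomology**,
`H^•_dR(X × 𝔸¹) ≅ H^•_dR(X)` for an affine `X = V(I) ⊆ 𝔸ⁿ` over a ring `k ⊇ ℚ` — the analogue
for the de Rham side of the homotopy invariance of singular cohomology, and the step by which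
Hartshorne's Poincaré lemma [Hartshorne1975, Ch. II Prop. 7.1] ("integration along the fibre of
`𝔸ⁿ⁺¹ → 𝔸ⁿ`") generalises from affine space to `X × 𝔸¹`. Everything is proved; no named facts.

We work on `𝔸ⁿ⁺¹ = 𝔸ⁿ × 𝔸¹` with last coordinate `t = x_{last}` and the tree's model
`AffineDeRham.PolyForm` of polynomial forms.

* `ALine.evalT` — the `k`-algebra endomorphism `f ↦ f(x, 0)` of `k[x, t]` (pull-back along
  `(x, t) ↦ (x, 0)` on functions); `ALine.intT` — integration along the fibre
  `∫₀^t : x^s t^m ↦ x^s t^{m+1}/(m+1)` (`k ⊇ ℚ`), with `∂_t ∘ ∫₀^t = id`,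
  `∫₀^t ∘ ∂_t = id − evalT`, `[∂_{xᵢ}, ∫₀^t] = 0`.
* `ALine.extDeriv_coeffMap` — for a coefficientwise operator `φ` commuting with the `∂_{xᵢ}` and with
  `[∂_t, φ] = ψ`: `d(φω) = φ(dω) + dt ∧ ψω`.
* `ALine.hOp ω = ∫₀^t (ι_{∂_t} ω)` (the homotopy) and `ALine.piOp ω = ω|_{t=0} − dt ∧ (ι_{∂_t}ω)|_{t=0}`
  (the projector onto forms pulled back from `𝔸ⁿ × 0`), with the **homotopy formula**
  `d(hω) + h(dω) = ω − Πω` (`ALine.extDeriv_hOp_add`; Cartan's formula for the constant field `∂_t`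
  from the tree, `curryLeft_extDeriv_add`).
* For an ideal `I' = (S) ⊆ k[x, t]` generated by polynomials not involving `t`
  (`evalT g = g` for `g ∈ S`, e.g. `I' = I·k[x, t]`): `h` and `Π` preserve the forms vanishing on
  `V(I')` (`ALine.hOp_mem`, `ALine.piOp_mem`), hence every form closed on `V(I')` is cohomologous
  to its projection `Πω` (`ALine.isExactOn_sub_piOp`), `Π` is a chain map (`ALine.piOp_extDeriv`),
  `Πω` is basic (`t`-free and without `dt`: `ALine.coeffMap_evalT_piOp`, `ALine.curryLeft_piOp_succ`) and
  `Π` is the identity on basic forms.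

The identification of `Π` with `pr^* ∘ i^*` and the resulting isomorphism
`H^•_dR(V(I) × 𝔸¹) ≅ H^•_dR(V(I))` use the pull-back of forms and are left to a sequel.

## References

* A. Grothendieck, *On the de Rham cohomology of algebraic varieties*, Publ. Math. IHÉS 29 (1966)
  95–103, Thm 1 and footnote (6). [Grothendieck1966]
* R. Hartshorne, *On the De Rham cohomology of algebraic varieties*, Publ. Math. IHÉS 45 (1975)
  5–99, Ch. II Prop. 7.1 (Poincaré lemma by integration along the fibre). [Hartshorne1975]
-/

noncomputable section

open MvPolynomial

namespace Literature.AlgebraicGeometry.Motives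

namespace AffineDeRham

namespace ALine

variable {k : Type*} [CommRing k] {n p : ℕ}

/-- Notation (local): `P1 = k[x₁, …, xₙ, t]`, the polynomial ring of `𝔸ⁿ × 𝔸¹`. -/
local notation "P1" => MvPolynomial (Fin (n + 1)) k

/-! ### Setting `t = 0` and integrating along `t` -/

/-- **Evaluation at `t = 0`**: the `k`-algebra endomorphism `f(x, t) ↦ f(x, 0)` of `k[x₁, …, xₙ, t]`
(`t = x_{last}`), i.e. composition with `(x, t) ↦ (x, 0)`. [folklore] -/
def evalT : MvPolynomial (Fin (n + 1)) k →ₐ[k] MvPolynomial (Fin (n + 1)) k :=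
  aeval (Fin.snoc (fun j : Fin n => X (Fin.castSucc j)) 0)

/-- `t ↦ 0`. [folklore] -/
@[simp]
theorem evalT_X_last : evalT (X (Fin.last n) : P1) = 0 := by
  simp [evalT]

/-- `xⱼ ↦ xⱼ`. [folklore] -/
@[simp]
theorem evalT_X_castSucc (j : Fin n) : evalT (X (Fin.castSucc j) : P1) = X (Fin.castSucc j) := by
  simp [evalT]

/-- `xᵢ ↦ xᵢ` for `i ≠ last`. [folklore] -/
theorem evalT_X_of_ne {i : Fin (n + 1)} (h : i ≠ Fin.last n) : evalT (X i : P1) = X i := by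
  obtain ⟨j, rfl⟩ := Fin.exists_castSucc_eq.mpr h
  exact evalT_X_castSucc j

/-- Constants are fixed. [folklore] -/
@[simp]
theorem evalT_C (a : k) : evalT (C a : P1) = C a :=
  algHom_C _ _

/-- `evalT` on monomials: `x^s ↦ x^s` if `t ∤ x^s`, else `0`. [folklore] -/
theorem evalT_monomial (s : Fin (n + 1) →₀ ℕ) (a : k) :
    evalT (monomial s a : P1) = if s (Fin.last n) = 0 then monomial s a else 0 := by
  have hm : (monomial s a : P1) = C a * (∏ j : Fin n, X (Fin.castSucc j) ^ s (Fin.castSucc j)) *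
      X (Fin.last n) ^ s (Fin.last n) := by
    rw [monomial_eq, Finsupp.prod_fintype _ _ (fun i => pow_zero _), Fin.prod_univ_castSucc, mul_assoc]
  have he : evalT (monomial s a : P1) = C a * (∏ j : Fin n, X (Fin.castSucc j) ^ s (Fin.castSucc j)) *
      (0 : P1) ^ s (Fin.last n) := by
    rw [evalT, aeval_monomial, Finsupp.prod_fintype _ _ (fun i => pow_zero _), Fin.prod_univ_castSucc,
      algebraMap_eq, mul_assoc]
    simp
  split_ifs with h
  · rw [he, hm, h, pow_zero, pow_zero]
  · rw [he, zero_pow h, mul_zero]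

/-- `evalT` is idempotent. [folklore] -/
@[simp]
theorem evalT_evalT (f : P1) : evalT (evalT f) = evalT f := by
  have h : (evalT (n := n) (k := k)).comp evalT = evalT := by
    refine algHom_ext fun i => ?_
    rw [AlgHom.comp_apply]
    by_cases hi : i = Fin.last n
    · rw [hi, evalT_X_last, map_zero]
    · rw [evalT_X_of_ne hi, evalT_X_of_ne hi]
  exact AlgHom.congr_fun h f

/-- `evalT ∘ evalT = evalT` as linear maps. [folklore] -/
theorem evalT_comp_evalT :
    (evalT (n := n) (k := k)).toLinearMap ∘ₗ evalT.toLinearMap = evalT.toLinearMap :=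
  LinearMap.ext fun f => evalT_evalT f

/-- `∂/∂xᵢ (xⱼ|_{t=0}) = (∂xⱼ/∂xᵢ)|_{t=0}` for `i ≠ last` (both sides are the constant `δᵢⱼ`, or `0`
for `j = last`). [folklore] -/
theorem pderiv_evalT_X {i : Fin (n + 1)} (hi : i ≠ Fin.last n) (j : Fin (n + 1)) :
    pderiv i (evalT (X j : P1)) = evalT (pderiv i (X j : P1)) := by
  classical
  by_cases hj : j = Fin.last n
  · subst hj
    rw [evalT_X_last, map_zero, pderiv_X, Pi.single_eq_of_ne (Ne.symm hi), map_zero]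
  · rw [evalT_X_of_ne hj, pderiv_X]
    by_cases hij : i = j
    · subst hij
      rw [Pi.single_eq_same, map_one]
    · rw [Pi.single_eq_of_ne (Ne.symm hij), map_zero]

/-- **`∂_t (f(x, 0)) = 0`.** [folklore] -/
@[simp]
theorem pderiv_last_evalT (f : P1) : pderiv (Fin.last n) (evalT f) = 0 := by
  induction f using MvPolynomial.induction_on with
  | C a => simp
  | add p q hp hq => rw [map_add, map_add, hp, hq, add_zero]
  | mul_X p i hp =>
    rw [map_mul, Derivation.leibniz, hp, smul_zero, add_zero, smul_eq_mul]
    by_cases hi : i = Fin.last n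
    · rw [hi, evalT_X_last, map_zero, mul_zero]
    · rw [evalT_X_of_ne hi, pderiv_X, Pi.single_eq_of_ne hi, mul_zero]

/-- **`∂_{xᵢ}` commutes with `t ↦ 0`** (`i ≠ last`). [folklore] -/
theorem pderiv_evalT_of_ne {i : Fin (n + 1)} (hi : i ≠ Fin.last n) (f : P1) :
    pderiv i (evalT f) = evalT (pderiv i f) := by
  induction f using MvPolynomial.induction_on with
  | C a => simp
  | add p q hp hq => rw [map_add, map_add, hp, hq, map_add, map_add]
  | mul_X p j hp =>
    rw [map_mul, Derivation.leibniz, Derivation.leibniz, smul_eq_mul, smul_eq_mul, smul_eq_mul,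
      smul_eq_mul, map_add, map_mul, map_mul, hp, pderiv_evalT_X hi]

/-- `∂_t ∘ evalT = 0` as linear maps. [folklore] -/
theorem pderiv_last_comp_evalT :
    ((pderiv (Fin.last n) : Derivation k P1 P1) : P1 →ₗ[k] P1) ∘ₗ (evalT (n := n) (k := k)).toLinearMap = 0 :=
  LinearMap.ext fun f => pderiv_last_evalT f

/-- `∂ᵢ ∘ evalT = evalT ∘ ∂ᵢ` as linear maps (`i ≠ last`). [folklore] -/
theorem pderiv_comp_evalT_of_ne {i : Fin (n + 1)} (hi : i ≠ Fin.last n) :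
    ((pderiv i : Derivation k P1 P1) : P1 →ₗ[k] P1) ∘ₗ (evalT (n := n) (k := k)).toLinearMap =
      evalT.toLinearMap ∘ₗ ((pderiv i : Derivation k P1 P1) : P1 →ₗ[k] P1) :=
  LinearMap.ext fun f => pderiv_evalT_of_ne hi f

section RatAlgebra

variable [Algebra ℚ k]

/-- **Integration along the fibre** `∫₀^t dt` on `k[x₁, …, xₙ, t]` over `k ⊇ ℚ`: the `k`-linear map
with `x^s t^m ↦ x^s t^{m+1}/(m+1)`, defined on the monomial basis. [cite: Hartshorne1975, Ch. II Prop. 7.1] -/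
def intT : P1 →ₗ[k] P1 :=
  (basisMonomials (Fin (n + 1)) k).constr k fun s =>
    monomial (s + Finsupp.single (Fin.last n) 1) (algebraMap ℚ k ((s (Fin.last n) + 1 : ℕ) : ℚ)⁻¹)

/-- `∫₀^t x^s = x^{s + e_t}/(s_t + 1)`. [folklore] -/
theorem intT_monomial_one (s : Fin (n + 1) →₀ ℕ) :
    intT (monomial s (1 : k)) =
      monomial (s + Finsupp.single (Fin.last n) 1) (algebraMap ℚ k ((s (Fin.last n) + 1 : ℕ) : ℚ)⁻¹) := by
  have h := (basisMonomials (Fin (n + 1)) k).constr_basis k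
    (fun s => monomial (s + Finsupp.single (Fin.last n) 1)
      (algebraMap ℚ k ((s (Fin.last n) + 1 : ℕ) : ℚ)⁻¹)) s
  rwa [coe_basisMonomials] at h

/-- `∫₀^t (a x^s) = a x^{s + e_t}/(s_t + 1)`. [folklore] -/
theorem intT_monomial (s : Fin (n + 1) →₀ ℕ) (a : k) :
    intT (monomial s a) =
      monomial (s + Finsupp.single (Fin.last n) 1) (a * algebraMap ℚ k ((s (Fin.last n) + 1 : ℕ) : ℚ)⁻¹) := by
  have h : (monomial s a : P1) = a • monomial s (1 : k) := by rw [smul_monomial, smul_eq_mul, mul_one]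
  rw [h, map_smul, intT_monomial_one, smul_monomial, smul_eq_mul]

/-- **`∂_t ∘ ∫₀^t = id`.** [cite: Hartshorne1975, Ch. II Prop. 7.1] -/
theorem pderiv_last_comp_intT :
    ((pderiv (Fin.last n) : Derivation k P1 P1) : P1 →ₗ[k] P1) ∘ₗ intT = LinearMap.id := by
  refine (basisMonomials (Fin (n + 1)) k).ext fun s => ?_
  simp only [LinearMap.comp_apply, coe_basisMonomials, LinearMap.id_apply, Derivation.coeFn_coe]
  rw [intT_monomial_one, pderiv_monomial, add_tsub_cancel_right, Finsupp.add_apply,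
    Finsupp.single_eq_same, mul_comm, ← nsmul_eq_mul, nsmul_algebraMap_inv (Nat.succ_ne_zero _)]

/-- `∂_t (∫₀^t f) = f`. [cite: Hartshorne1975, Ch. II Prop. 7.1] -/
@[simp]
theorem pderiv_last_intT (f : P1) : pderiv (Fin.last n) (intT f) = f := by
  have h := LinearMap.congr_fun (pderiv_last_comp_intT (n := n) (k := k)) f
  simpa only [LinearMap.comp_apply, Derivation.coeFn_coe, LinearMap.id_apply] using h

/-- **`∫₀^t ∘ ∂_t = id − evalT`** (the fundamental theorem of calculus along the fibre).
[cite: Hartshorne1975, Ch. II Prop. 7.1] -/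
theorem intT_comp_pderiv_last :
    intT ∘ₗ ((pderiv (Fin.last n) : Derivation k P1 P1) : P1 →ₗ[k] P1) =
      LinearMap.id - (evalT (n := n) (k := k)).toLinearMap := by
  refine (basisMonomials (Fin (n + 1)) k).ext fun s => ?_
  simp only [LinearMap.comp_apply, coe_basisMonomials, LinearMap.sub_apply, LinearMap.id_apply,
    AlgHom.toLinearMap_apply, Derivation.coeFn_coe]
  rw [pderiv_monomial, one_mul, evalT_monomial]
  rcases Nat.eq_zero_or_pos (s (Fin.last n)) with h0 | hpos
  · rw [h0, Nat.cast_zero, map_zero, map_zero, if_pos rfl, sub_self]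
  · have hne : s (Fin.last n) ≠ 0 := Nat.pos_iff_ne_zero.mp hpos
    have hle : Finsupp.single (Fin.last n) 1 ≤ s := Finsupp.single_le_iff.mpr (Nat.succ_le_of_lt hpos)
    rw [if_neg hne, sub_zero, intT_monomial, Finsupp.tsub_apply, Finsupp.single_eq_same,
      Nat.sub_add_cancel (Nat.succ_le_of_lt hpos), tsub_add_cancel_of_le hle, ← nsmul_eq_mul,
      nsmul_algebraMap_inv hne]

/-- `∫₀^t (∂_t f) = f − f(x, 0)`. [cite: Hartshorne1975, Ch. II Prop. 7.1] -/
theorem intT_pderiv_last (f : P1) : intT (pderiv (Fin.last n) f) = f - evalT f := by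
  have h := LinearMap.congr_fun (intT_comp_pderiv_last (n := n) (k := k)) f
  simpa only [LinearMap.comp_apply, Derivation.coeFn_coe, LinearMap.sub_apply, LinearMap.id_apply,
    AlgHom.toLinearMap_apply] using h

/-- **`∂_{xᵢ}` commutes with `∫₀^t dt`** (`i ≠ last`). [folklore] -/
theorem pderiv_comp_intT_of_ne {i : Fin (n + 1)} (hi : i ≠ Fin.last n) :
    ((pderiv i : Derivation k P1 P1) : P1 →ₗ[k] P1) ∘ₗ intT =
      intT ∘ₗ ((pderiv i : Derivation k P1 P1) : P1 →ₗ[k] P1) := by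
  refine (basisMonomials (Fin (n + 1)) k).ext fun s => ?_
  simp only [LinearMap.comp_apply, coe_basisMonomials, Derivation.coeFn_coe]
  rw [intT_monomial_one, pderiv_monomial, pderiv_monomial, one_mul, intT_monomial, Finsupp.add_apply,
    Finsupp.single_eq_of_ne hi, add_zero, Finsupp.tsub_apply, Finsupp.single_eq_of_ne (Ne.symm hi),
    tsub_zero, mul_comm]
  rcases Nat.eq_zero_or_pos (s i) with h0 | hpos
  · rw [h0, Nat.cast_zero, zero_mul, map_zero, map_zero]
  · rw [tsub_add_eq_add_tsub (Finsupp.single_le_iff.mpr (Nat.succ_le_of_lt hpos))]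

/-- `∂_{xᵢ} (∫₀^t f) = ∫₀^t (∂_{xᵢ} f)` (`i ≠ last`). [folklore] -/
theorem pderiv_intT_of_ne {i : Fin (n + 1)} (hi : i ≠ Fin.last n) (f : P1) :
    pderiv i (intT f) = intT (pderiv i f) := by
  have h := LinearMap.congr_fun (pderiv_comp_intT_of_ne (k := k) hi) f
  simpa only [LinearMap.comp_apply, Derivation.coeFn_coe] using h

/-- **`∫₀^t` is linear over the polynomials not involving `t`**: `∫₀^t (g(x,0) · a) = g(x,0) · ∫₀^t a`.
[folklore] -/
theorem intT_evalT_mul (g a : P1) : intT (evalT g * a) = evalT g * intT a := by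
  induction g using MvPolynomial.induction_on' with
  | monomial s c =>
    rw [evalT_monomial]
    split_ifs with hs
    · induction a using MvPolynomial.induction_on' with
      | monomial r b =>
        rw [monomial_mul, intT_monomial, intT_monomial, monomial_mul, Finsupp.add_apply, hs, zero_add,
          add_assoc, mul_assoc]
      | add p q hp hq => rw [mul_add, map_add, hp, hq, map_add, mul_add]
    · rw [zero_mul, map_zero, zero_mul]
  | add p q hp hq => rw [map_add, add_mul, map_add, hp, hq, add_mul]

end RatAlgebra

/-! ### Coefficientwise operators and the exterior derivative -/

/-- `coeffMap φ` is additive in the form. [folklore] -/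
theorem coeffMap_add_form (φ : P1 →ₗ[k] P1) (a b : PolyForm k (n + 1) p) :
    coeffMap φ (a + b) = coeffMap φ a + coeffMap φ b :=
  AlternatingMap.ext fun v => by simp

/-- `coeffMap φ` commutes with subtraction of forms. [folklore] -/
theorem coeffMap_sub_form (φ : P1 →ₗ[k] P1) (a b : PolyForm k (n + 1) p) :
    coeffMap φ (a - b) = coeffMap φ a - coeffMap φ b :=
  AlternatingMap.ext fun v => by simp

/-- `coeffMap` is additive in the operator. [folklore] -/
theorem coeffMap_add_op (φ ψ : P1 →ₗ[k] P1) (ω : PolyForm k (n + 1) p) :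
    coeffMap (φ + ψ) ω = coeffMap φ ω + coeffMap ψ ω :=
  AlternatingMap.ext fun _ => rfl

/-- `coeffMap` commutes with subtraction of operators. [folklore] -/
theorem coeffMap_sub_op (φ ψ : P1 →ₗ[k] P1) (ω : PolyForm k (n + 1) p) :
    coeffMap (φ - ψ) ω = coeffMap φ ω - coeffMap ψ ω :=
  AlternatingMap.ext fun _ => rfl

/-- `coeffMap` commutes with contraction by a constant field. [folklore] -/
theorem curryLeft_coeffMap (φ : P1 →ₗ[k] P1) (ω : PolyForm k (n + 1) (p + 1)) (x : Fin (n + 1) → ℤ) :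
    (coeffMap φ ω).curryLeft x = coeffMap φ (ω.curryLeft x) :=
  AlternatingMap.ext fun _ => rfl

/-- `coeffMap φ` on a `0`-form. [folklore] -/
theorem coeffMap_ofPoly (φ : P1 →ₗ[k] P1) (f : P1) : coeffMap φ (ofPoly f) = ofPoly (φ f) :=
  AlternatingMap.ext fun _ => rfl

/-- A coefficientwise algebra endomorphism is multiplicative: `E(f ω) = E(f) E(ω)`. [folklore] -/
theorem coeffMap_algHom_smul (E : P1 →ₐ[k] P1) (f : P1) (ω : PolyForm k (n + 1) p) :
    coeffMap E.toLinearMap (f • ω) = E f • coeffMap E.toLinearMap ω :=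
  AlternatingMap.ext fun v => by simp

/-- Contraction by a constant field is `P`-linear: `ι_x (f ω) = f ι_x ω`. [folklore] -/
theorem curryLeft_smul_poly (f : P1) (ω : PolyForm k (n + 1) (p + 1)) (x : Fin (n + 1) → ℤ) :
    (f • ω).curryLeft x = f • ω.curryLeft x :=
  AlternatingMap.ext fun _ => rfl

/-- `ι_x (df) = ∂_x f` for a polynomial `f`. [folklore] -/
theorem curryLeft_extDeriv_ofPoly (f : P1) (x : Fin (n + 1) → ℤ) :
    (extDeriv (ofPoly f)).curryLeft x = ofPoly (dirDeriv x f) :=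
  AlternatingMap.ext fun v => by
    rw [AlternatingMap.curryLeft_apply_apply, extDeriv_ofPoly_apply, ofPoly_apply]
    rfl

/-- The Lie derivative along the coordinate field `eᵢ` is `∂/∂xᵢ` on the coefficients. [folklore] -/
theorem lieAlong_single_eq_coeffMap (ω : PolyForm k (n + 1) p) (i : Fin (n + 1)) :
    lieAlong ω (Pi.single i 1) = coeffMap ((pderiv i : Derivation k P1 P1) : P1 →ₗ[k] P1) ω :=
  AlternatingMap.ext fun u => by
    rw [lieAlong_apply, coeffMap_apply, dirDeriv_single]
    rfl

/-- `d` commutes with subtraction. [folklore] -/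
theorem extDeriv_sub' (a b : PolyForm k (n + 1) p) : extDeriv (a - b) = extDeriv a - extDeriv b :=
  map_sub (extDerivₗ k (n + 1) p) a b

/-- **Directional derivatives of a coefficientwise operator.** If `φ` commutes with `∂/∂xᵢ` for
`i ≠ last` and `∂_t ∘ φ = φ ∘ ∂_t + ψ`, then `∂_w (φ f) = φ (∂_w f) + w_t ψ(f)`. [folklore] -/
theorem dirDeriv_of_commute (φ ψ : P1 →ₗ[k] P1)
    (hcomm : ∀ i : Fin (n + 1), i ≠ Fin.last n →
      ((pderiv i : Derivation k P1 P1) : P1 →ₗ[k] P1) ∘ₗ φ =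
        φ ∘ₗ ((pderiv i : Derivation k P1 P1) : P1 →ₗ[k] P1))
    (hlast : ((pderiv (Fin.last n) : Derivation k P1 P1) : P1 →ₗ[k] P1) ∘ₗ φ =
      φ ∘ₗ ((pderiv (Fin.last n) : Derivation k P1 P1) : P1 →ₗ[k] P1) + ψ)
    (w : Fin (n + 1) → ℤ) (f : P1) :
    dirDeriv w (φ f) = φ (dirDeriv w f) + C ((w (Fin.last n) : ℤ) : k) * ψ f := by
  have h1 : ∀ i, pderiv i (φ f) = φ (pderiv i f) + (if i = Fin.last n then ψ f else 0) := by
    intro i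
    by_cases hi : i = Fin.last n
    · subst hi
      have h := LinearMap.congr_fun hlast f
      simp only [LinearMap.comp_apply, Derivation.coeFn_coe, LinearMap.add_apply] at h
      rw [h, if_pos rfl]
    · have h := LinearMap.congr_fun (hcomm i hi) f
      simp only [LinearMap.comp_apply, Derivation.coeFn_coe] at h
      rw [h, if_neg hi, add_zero]
  rw [dirDeriv_apply, dirDeriv_apply, map_sum]
  simp only [h1, smul_add, smul_ite, smul_zero, Finset.sum_add_distrib, Finset.sum_ite_eq',
    Finset.mem_univ, if_true, map_smul]
  congr 1
  exact MvPolynomial.smul_eq_C_mul _ _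

/-- **The exterior derivative of a coefficientwise operator**: under the hypotheses of
`dirDeriv_of_commute`, `d(φ η) = φ(dη) + dt ∧ ψ(η)`. [folklore] -/
theorem extDeriv_coeffMap (φ ψ : P1 →ₗ[k] P1)
    (hcomm : ∀ i : Fin (n + 1), i ≠ Fin.last n →
      ((pderiv i : Derivation k P1 P1) : P1 →ₗ[k] P1) ∘ₗ φ =
        φ ∘ₗ ((pderiv i : Derivation k P1 P1) : P1 →ₗ[k] P1))
    (hlast : ((pderiv (Fin.last n) : Derivation k P1 P1) : P1 →ₗ[k] P1) ∘ₗ φ =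
      φ ∘ₗ ((pderiv (Fin.last n) : Derivation k P1 P1) : P1 →ₗ[k] P1) + ψ)
    (η : PolyForm k (n + 1) p) :
    extDeriv (coeffMap φ η) = coeffMap φ (extDeriv η) + dWedge (X (Fin.last n)) (coeffMap ψ η) := by
  refine AlternatingMap.ext fun v => ?_
  simp only [extDeriv_apply, coeffMap_apply, AlternatingMap.add_apply, dWedge_apply, dirDeriv_X,
    dirDeriv_of_commute φ ψ hcomm hlast, mul_add, Finset.sum_add_distrib, map_sum]
  congr 1
  refine Finset.sum_congr rfl fun i _ => ?_
  rcases neg_one_pow_eq_or (MvPolynomial (Fin (n + 1)) k) i with h | h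
  · rw [h, one_mul, one_mul]
  · rw [h, neg_one_mul, neg_one_mul, map_neg]

/-- **Contraction of `df ∧ η` with a constant field**: `ι_x(df ∧ η) = (∂_x f) η − df ∧ ι_x η`
(`ι_x` is a graded derivation). [folklore] -/
theorem curryLeft_dWedge (f : P1) (η : PolyForm k (n + 1) (p + 1)) (x : Fin (n + 1) → ℤ) :
    (dWedge f η).curryLeft x = dirDeriv x f • η - dWedge f (η.curryLeft x) := by
  have h := curryLeft_alternatizeUncurryFin_add ((grad f).smulRight η) x
  have hF : AlternatingMap.curryLeftLinearMap.flip x ∘ₗ (grad f).smulRight η =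
      (grad f).smulRight (η.curryLeft x) := by
    refine LinearMap.ext fun v => ?_
    simp only [LinearMap.coe_comp, Function.comp_apply, LinearMap.smulRight_apply, grad_apply,
      LinearMap.flip_apply, AlternatingMap.curryLeftLinearMap_apply]
    exact curryLeft_smul_poly _ _ _
  rw [hF, LinearMap.smulRight_apply, grad_apply] at h
  exact eq_sub_of_add_eq h

/-- In degree `0`: `ι_x(df ∧ η) = (∂_x f) η` for a `0`-form `η`. [folklore] -/
theorem curryLeft_dWedge_zero (f : P1) (η : PolyForm k (n + 1) 0) (x : Fin (n + 1) → ℤ) :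
    (dWedge f η).curryLeft x = dirDeriv x f • η := by
  refine AlternatingMap.ext fun v => ?_
  rw [AlternatingMap.curryLeft_apply_apply, dWedge_apply, Fin.sum_univ_one, AlternatingMap.smul_apply,
    smul_eq_mul]
  simp only [Fin.val_zero, pow_zero, one_mul, Matrix.cons_val_zero]
  congr 1

/-- `df ∧ θ` vanishes on `X` whenever `θ` does (`df ∧ θ = d(fθ) − f dθ`). [folklore] -/
theorem dWedge_mem_vanishingForms_right (I : Ideal P1) (f : P1) {θ : PolyForm k (n + 1) p}
    (hθ : θ ∈ vanishingForms I p) : dWedge f θ ∈ vanishingForms I (p + 1) := by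
  have h : dWedge f θ = extDeriv (f • θ) - f • extDeriv θ := by rw [extDeriv_smul, add_sub_cancel_right]
  rw [h]
  exact Submodule.sub_mem _ (extDeriv_mem_vanishingForms _ (Submodule.smul_mem _ _ hθ))
    (Submodule.smul_mem _ _ (extDeriv_mem_vanishingForms _ hθ))

/-- `dWedge` is additive in the function. [folklore] -/
theorem dWedge_add_fun (f g : P1) (η : PolyForm k (n + 1) p) :
    dWedge (f + g) η = dWedge f η + dWedge g η := by
  refine AlternatingMap.ext fun v => ?_
  simp only [dWedge_apply, map_add, AlternatingMap.add_apply, ← Finset.sum_add_distrib]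
  exact Finset.sum_congr rfl fun i _ => by ring

/-- `df ∧ (a − b) = df ∧ a − df ∧ b`. [folklore] -/
theorem dWedge_sub_right' (f : P1) (a b : PolyForm k (n + 1) p) :
    dWedge f (a - b) = dWedge f a - dWedge f b := by
  refine AlternatingMap.ext fun v => ?_
  simp only [dWedge_apply, AlternatingMap.sub_apply, mul_sub, Finset.sum_sub_distrib]

/-- `d0 ∧ η = 0`. [folklore] -/
theorem dWedge_zero_fun (η : PolyForm k (n + 1) p) : dWedge (0 : P1) η = 0 := by
  refine AlternatingMap.ext fun v => ?_
  simp [dWedge_apply]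

/-- Contraction with `∂_t`, bundled `P`-linearly. [folklore] -/
def contrT (p : ℕ) : PolyForm k (n + 1) (p + 1) →ₗ[P1] PolyForm k (n + 1) p where
  toFun ω := ω.curryLeft (Pi.single (Fin.last n) 1)
  map_add' a b := by
    rw [AlternatingMap.curryLeft_add, LinearMap.add_apply]
  map_smul' f ω := curryLeft_smul_poly f ω _

/-- `contrT` is contraction with `∂_t`. [folklore] -/
@[simp]
theorem contrT_apply (ω : PolyForm k (n + 1) (p + 1)) : contrT p ω = ω.curryLeft (Pi.single (Fin.last n) 1) :=
  rfl

/-- Contraction with `∂_t` commutes with subtraction. [folklore] -/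
theorem curryLeft_last_sub (a b : PolyForm k (n + 1) (p + 1)) :
    (a - b).curryLeft (Pi.single (Fin.last n) 1) =
      a.curryLeft (Pi.single (Fin.last n) 1) - b.curryLeft (Pi.single (Fin.last n) 1) :=
  map_sub (contrT p) a b

/-! ### The homotopy operator and the projector -/

/-- **The projector `Π`** onto forms pulled back from the zero section `𝔸ⁿ × 0`:
`Π ω = ω|_{t=0} − dt ∧ (ι_{∂_t} ω)|_{t=0}` (coefficients evaluated at `t = 0`, `dt`-components
removed); in degree `0`, `Π f = f(x, 0)`. This is the pull-back along `(x, t) ↦ (x, 0)`.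
[cite: Hartshorne1975, Ch. II Prop. 7.1] -/
def piOp : {p : ℕ} → PolyForm k (n + 1) p → PolyForm k (n + 1) p
  | 0, ω => coeffMap (evalT (n := n) (k := k)).toLinearMap ω
  | _ + 1, ω => coeffMap (evalT (n := n) (k := k)).toLinearMap ω -
      dWedge (X (Fin.last n)) (coeffMap (evalT (n := n) (k := k)).toLinearMap
        (ω.curryLeft (Pi.single (Fin.last n) 1)))

/-- `Π` in degree `0`. [folklore] -/
theorem piOp_zero_eq (ω : PolyForm k (n + 1) 0) : piOp ω = coeffMap evalT.toLinearMap ω :=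
  rfl

/-- `Π` in positive degree. [folklore] -/
theorem piOp_succ_eq (ω : PolyForm k (n + 1) (p + 1)) :
    piOp ω = coeffMap evalT.toLinearMap ω -
      dWedge (X (Fin.last n)) (coeffMap evalT.toLinearMap (ω.curryLeft (Pi.single (Fin.last n) 1))) :=
  rfl

/-- `Π` of a `0`-form `f` is `f(x, 0)`. [folklore] -/
@[simp]
theorem piOp_ofPoly (f : P1) : piOp (ofPoly f) = ofPoly (evalT f) :=
  coeffMap_ofPoly _ f

/-- **Setting `t = 0` in the coefficients of `df ∧ η`**:
`(df ∧ η)|₀ = d(f|₀) ∧ η|₀ + (∂_t f)|₀ dt ∧ η|₀` (the chain rule `(∂_w f)|₀ = ∂_w(f|₀) + w_t (∂_t f)|₀`).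
[folklore] -/
theorem coeffMap_evalT_dWedge (f : P1) (η : PolyForm k (n + 1) p) :
    coeffMap evalT.toLinearMap (dWedge f η) =
      dWedge (evalT f) (coeffMap evalT.toLinearMap η) +
        evalT (pderiv (Fin.last n) f) • dWedge (X (Fin.last n)) (coeffMap evalT.toLinearMap η) := by
  have key : ∀ (w : Fin (n + 1) → ℤ) (g : P1), evalT (dirDeriv w g) =
      dirDeriv w (evalT g) + C ((w (Fin.last n) : ℤ) : k) * evalT (pderiv (Fin.last n) g) := by
    intro w g
    have h := dirDeriv_of_commute (evalT (n := n) (k := k)).toLinearMap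
      (-((evalT (n := n) (k := k)).toLinearMap ∘ₗ
        ((pderiv (Fin.last n) : Derivation k P1 P1) : P1 →ₗ[k] P1)))
      (fun i hi => pderiv_comp_evalT_of_ne hi) (by rw [pderiv_last_comp_evalT, add_neg_cancel]) w g
    simp only [AlgHom.toLinearMap_apply, LinearMap.neg_apply, LinearMap.comp_apply,
      Derivation.coeFn_coe] at h
    linear_combination (-1 : MvPolynomial (Fin (n + 1)) k) * h
  refine AlternatingMap.ext fun v => ?_
  simp only [coeffMap_apply, dWedge_apply, AlternatingMap.add_apply, AlternatingMap.smul_apply,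
    smul_eq_mul, map_sum, AlgHom.toLinearMap_apply, map_mul, dirDeriv_X, key, Finset.mul_sum,
    ← Finset.sum_add_distrib]
  refine Finset.sum_congr rfl fun i _ => ?_
  rcases neg_one_pow_eq_or (MvPolynomial (Fin (n + 1)) k) i with h | h
  · rw [h, map_one, one_mul, one_mul, one_mul]
    ring
  · rw [h, map_neg, map_one, neg_one_mul, neg_one_mul, neg_one_mul]
    ring

section RatAlgebra

variable [Algebra ℚ k]

/-- **The homotopy operator** `h ω = ∫₀^t (ι_{∂_t} ω)`: contract with the constant field `∂_t` and
integrate the coefficients along the fibre. [cite: Hartshorne1975, Ch. II Prop. 7.1] -/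
def hOp (ω : PolyForm k (n + 1) (p + 1)) : PolyForm k (n + 1) p :=
  coeffMap intT (ω.curryLeft (Pi.single (Fin.last n) 1))

/-- `h 0 = 0`. [folklore] -/
@[simp]
theorem hOp_zero : hOp (0 : PolyForm k (n + 1) (p + 1)) = 0 :=
  AlternatingMap.ext fun v => by simp [hOp]

/-- `h` is additive. [folklore] -/
theorem hOp_add (a b : PolyForm k (n + 1) (p + 1)) : hOp (a + b) = hOp a + hOp b :=
  AlternatingMap.ext fun v => by simp [hOp]

/-- **`d ∘ ∫₀^t = ∫₀^t ∘ d + dt ∧ evalT`** on forms (coefficientwise integration along the fibre).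
[cite: Hartshorne1975, Ch. II Prop. 7.1] -/
theorem extDeriv_coeffMap_intT (η : PolyForm k (n + 1) p) :
    extDeriv (coeffMap intT η) =
      coeffMap intT (extDeriv η) + dWedge (X (Fin.last n)) (coeffMap evalT.toLinearMap η) :=
  extDeriv_coeffMap intT evalT.toLinearMap (fun _ hi => pderiv_comp_intT_of_ne hi)
    (by rw [pderiv_last_comp_intT, intT_comp_pderiv_last, sub_add_cancel]) η

/-- **The homotopy formula** `d(hω) + h(dω) = ω − Πω` in positive degree: integration along the
fibre is a chain homotopy between the identity and the projector onto forms pulled back from the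
zero section (Cartan's formula `ι_{∂_t} d + d ι_{∂_t} = L_{∂_t}` and the fundamental theorem of
calculus `∫₀^t ∂_t = id − evalT`). [cite: Hartshorne1975, Ch. II Prop. 7.1] -/
theorem extDeriv_hOp_add (ω : PolyForm k (n + 1) (p + 1)) :
    extDeriv (hOp ω) + hOp (extDeriv ω) = ω - piOp ω := by
  rw [hOp, hOp, extDeriv_coeffMap_intT, add_right_comm, ← coeffMap_add_form,
    add_comm (extDeriv (ω.curryLeft _)) _, curryLeft_extDeriv_add, lieAlong_single_eq_coeffMap,
    ← coeffMap_comp, intT_comp_pderiv_last, coeffMap_sub_op, coeffMap_id, piOp_succ_eq]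
  abel

/-- The homotopy formula in degree `0`: `h(dω) = ω − Πω` (`∫₀^t ∂_t f = f − f(x,0)`).
[cite: Hartshorne1975, Ch. II Prop. 7.1] -/
theorem hOp_extDeriv_zero (ω : PolyForm k (n + 1) 0) : hOp (extDeriv ω) = ω - piOp ω := by
  obtain ⟨f, rfl⟩ := (ofPoly (k := k) (n := n + 1)).surjective ω
  rw [hOp, curryLeft_extDeriv_ofPoly, coeffMap_ofPoly, dirDeriv_single, piOp_ofPoly, ← map_sub]
  exact congrArg ofPoly (intT_pderiv_last f)

/-- **`Π` is a chain map**: `Π(dω) = d(Πω)` (from the homotopy formula). [folklore] -/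
theorem piOp_extDeriv : ∀ {p : ℕ} (ω : PolyForm k (n + 1) p), piOp (extDeriv ω) = extDeriv (piOp ω)
  | 0, ω => by
    have hA := congrArg extDeriv (hOp_extDeriv_zero ω)
    have hB := extDeriv_hOp_add (extDeriv ω)
    rw [extDeriv_extDeriv, hOp_zero, add_zero, hA, extDeriv_sub', sub_right_inj] at hB
    exact hB.symm
  | p + 1, ω => by
    have hA := congrArg extDeriv (extDeriv_hOp_add ω)
    have hB := extDeriv_hOp_add (extDeriv ω)
    rw [extDeriv_add, extDeriv_extDeriv, zero_add, extDeriv_sub'] at hA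
    rw [extDeriv_extDeriv, hOp_zero, add_zero, hA, sub_right_inj] at hB
    exact hB.symm

end RatAlgebra

/-! ### Basic forms: `Π` is a projector onto the `t`-free forms without `dt` -/

/-- `Πω` has `t`-free coefficients: `(Πω)|_{t=0} = Πω`. [folklore] -/
theorem coeffMap_evalT_piOp : ∀ {p : ℕ} (ω : PolyForm k (n + 1) p),
    coeffMap evalT.toLinearMap (piOp ω) = piOp ω
  | 0, ω => by rw [piOp_zero_eq, ← coeffMap_comp, evalT_comp_evalT]
  | p + 1, ω => by
    rw [piOp_succ_eq, coeffMap_sub_form, coeffMap_evalT_dWedge, evalT_X_last, dWedge_zero_fun, zero_add,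
      pderiv_X_self, map_one, one_smul, ← coeffMap_comp, ← coeffMap_comp, evalT_comp_evalT]

/-- `Πω` has no `dt`-component: `ι_{∂_t}(Πω) = 0` (degree `≥ 2`). [folklore] -/
theorem curryLeft_piOp_succ (ω : PolyForm k (n + 1) (p + 2)) :
    (piOp ω).curryLeft (Pi.single (Fin.last n) 1) = 0 := by
  rw [piOp_succ_eq, curryLeft_last_sub, curryLeft_dWedge, curryLeft_coeffMap, curryLeft_coeffMap,
    AlternatingMap.curryLeft_same, coeffMap_zero, dWedge_zero, sub_zero, dirDeriv_X, Pi.single_eq_same,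
    Int.cast_one, C_1, one_smul, sub_self]

/-- `Πω` has no `dt`-component: `ι_{∂_t}(Πω) = 0` (degree `1`). [folklore] -/
theorem curryLeft_piOp_one (ω : PolyForm k (n + 1) 1) :
    (piOp ω).curryLeft (Pi.single (Fin.last n) 1) = 0 := by
  rw [piOp_succ_eq, curryLeft_last_sub, curryLeft_dWedge_zero, curryLeft_coeffMap, dirDeriv_X,
    Pi.single_eq_same, Int.cast_one, C_1, one_smul, sub_self]

/-- **`Π` is the identity on basic forms** (positive degree): if `ω|_{t=0} = ω` and `ι_{∂_t} ω = 0`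
then `Πω = ω`. [folklore] -/
theorem piOp_eq_self_succ {ω : PolyForm k (n + 1) (p + 1)} (hE : coeffMap evalT.toLinearMap ω = ω)
    (hι : ω.curryLeft (Pi.single (Fin.last n) 1) = 0) : piOp ω = ω := by
  rw [piOp_succ_eq, hι, coeffMap_zero, dWedge_zero, sub_zero, hE]

/-- **`Π` is the identity on basic forms** (degree `0`): if `f(x, 0) = f` then `Π f = f`. [folklore] -/
theorem piOp_eq_self_zero {ω : PolyForm k (n + 1) 0} (hE : coeffMap evalT.toLinearMap ω = ω) :
    piOp ω = ω := by
  rw [piOp_zero_eq, hE]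

/-- `Π ∘ Π = Π`. [folklore] -/
theorem piOp_piOp : ∀ {p : ℕ} (ω : PolyForm k (n + 1) p), piOp (piOp ω) = piOp ω
  | 0, ω => piOp_eq_self_zero (coeffMap_evalT_piOp ω)
  | 1, ω => piOp_eq_self_succ (coeffMap_evalT_piOp ω) (curryLeft_piOp_one ω)
  | _ + 2, ω => piOp_eq_self_succ (coeffMap_evalT_piOp ω) (curryLeft_piOp_succ ω)

/-- `Π` commutes with subtraction. [folklore] -/
theorem piOp_sub : ∀ {p : ℕ} (a b : PolyForm k (n + 1) p), piOp (a - b) = piOp a - piOp b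
  | 0, a, b => by rw [piOp_zero_eq, piOp_zero_eq, piOp_zero_eq, coeffMap_sub_form]
  | p + 1, a, b => by
    rw [piOp_succ_eq, piOp_succ_eq, piOp_succ_eq, coeffMap_sub_form, curryLeft_last_sub, coeffMap_sub_form,
      dWedge_sub_right']
    abel

/-! ### Ideals generated by `t`-free polynomials: `h` and `Π` preserve the forms vanishing on `V(I')` -/

section TFree

variable {S : Set (MvPolynomial (Fin (n + 1)) k)} (hS : ∀ g ∈ S, evalT g = g)
include hS

/-- An ideal generated by `t`-free polynomials is stable under `t ↦ 0`. [folklore] -/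
theorem evalT_mem_span {f : P1} (hf : f ∈ Ideal.span S) : evalT f ∈ Ideal.span S := by
  induction hf using Submodule.span_induction with
  | mem g hg => rw [hS g hg]; exact Ideal.subset_span hg
  | zero => rw [map_zero]; exact Submodule.zero_mem _
  | add x y _ _ hx hy => rw [map_add]; exact Ideal.add_mem _ hx hy
  | smul a x _ hx => rw [smul_eq_mul, map_mul]; exact Ideal.mul_mem_left _ _ hx

/-- An ideal generated by `t`-free polynomials is stable under `∂/∂t`. [folklore] -/
theorem pderiv_last_mem_span {f : P1} (hf : f ∈ Ideal.span S) : pderiv (Fin.last n) f ∈ Ideal.span S := by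
  induction hf using Submodule.span_induction with
  | mem g hg => rw [← hS g hg, pderiv_last_evalT]; exact Submodule.zero_mem _
  | zero => rw [map_zero]; exact Submodule.zero_mem _
  | add x y _ _ hx hy => rw [map_add]; exact Ideal.add_mem _ hx hy
  | smul a x hx' hx =>
    rw [smul_eq_mul, Derivation.leibniz, smul_eq_mul, smul_eq_mul]
    exact Ideal.add_mem _ (Ideal.mul_mem_left _ _ hx) (Ideal.mul_mem_right _ _ hx')

omit hS in
/-- The partial derivatives of a `t`-free polynomial are `t`-free. [folklore] -/
theorem evalT_dirDeriv_of_tfree {g : P1} (hg : evalT g = g) (w : Fin (n + 1) → ℤ) :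
    evalT (dirDeriv w g) = dirDeriv w g := by
  have h := dirDeriv_of_commute (evalT (n := n) (k := k)).toLinearMap
    (-((evalT (n := n) (k := k)).toLinearMap ∘ₗ
      ((pderiv (Fin.last n) : Derivation k P1 P1) : P1 →ₗ[k] P1)))
    (fun i hi => pderiv_comp_evalT_of_ne hi) (by rw [pderiv_last_comp_evalT, add_neg_cancel]) w g
  simp only [AlgHom.toLinearMap_apply, LinearMap.neg_apply, LinearMap.comp_apply,
    Derivation.coeFn_coe] at h
  have h0 : pderiv (Fin.last n) g = 0 := by rw [← hg, pderiv_last_evalT]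
  rw [hg, h0, map_zero, neg_zero, mul_zero, add_zero] at h
  exact h.symm

/-- **`ι_{∂_t}` preserves the forms vanishing on `V(I')`** for `I'` generated by `t`-free
polynomials (`ι_{∂_t}(df ∧ η) = (∂_t f) η − df ∧ ι_{∂_t} η` and `∂_t I' ⊆ I'`). [folklore] -/
theorem curryLeft_mem_vanishingForms {ω : PolyForm k (n + 1) (p + 1)}
    (hω : ω ∈ vanishingForms (Ideal.span S) (p + 1)) :
    ω.curryLeft (Pi.single (Fin.last n) 1) ∈ vanishingForms (Ideal.span S) p := by
  suffices h : vanishingForms (Ideal.span S) (p + 1) ≤ (vanishingForms (Ideal.span S) p).comap (contrT p) from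
    h hω
  rw [vanishingForms_succ]
  refine sup_le (Submodule.smul_le.mpr fun f hf θ _ => ?_) (Submodule.span_le.mpr ?_)
  · rw [Submodule.mem_comap, map_smul]
    exact smul_mem_vanishingForms _ hf _
  · rintro _ ⟨f, hf, η, rfl⟩
    rw [SetLike.mem_coe, Submodule.mem_comap, contrT_apply]
    cases p with
    | zero =>
      rw [curryLeft_dWedge_zero, dirDeriv_single]
      exact smul_mem_vanishingForms _ (pderiv_last_mem_span hS hf) _
    | succ q =>
      rw [curryLeft_dWedge, dirDeriv_single]
      exact Submodule.sub_mem _ (smul_mem_vanishingForms _ (pderiv_last_mem_span hS hf) _)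
        (dWedge_mem_vanishingForms _ hf _)

/-- **`t ↦ 0` on the coefficients preserves the forms vanishing on `V(I')`** for `I'` generated by
`t`-free polynomials. [folklore] -/
theorem coeffMap_evalT_mem_vanishingForms {ω : PolyForm k (n + 1) p}
    (hω : ω ∈ vanishingForms (Ideal.span S) p) :
    coeffMap evalT.toLinearMap ω ∈ vanishingForms (Ideal.span S) p := by
  let N : Submodule P1 (PolyForm k (n + 1) p) :=
    { carrier := {ω | coeffMap evalT.toLinearMap ω ∈ vanishingForms (Ideal.span S) p}
      add_mem' := fun {a b} ha hb => by
        simp only [Set.mem_setOf_eq, coeffMap_add_form] at ha hb ⊢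
        exact Submodule.add_mem _ ha hb
      zero_mem' := by simp
      smul_mem' := fun f ω hω => by
        simp only [Set.mem_setOf_eq] at hω ⊢
        rw [coeffMap_algHom_smul]
        exact Submodule.smul_mem _ _ hω }
  suffices h : vanishingForms (Ideal.span S) p ≤ N from h hω
  have hI : Ideal.span S • (⊤ : Submodule P1 (PolyForm k (n + 1) p)) ≤ N :=
    Submodule.smul_le.mpr fun f hf θ _ => by
      show coeffMap evalT.toLinearMap (f • θ) ∈ vanishingForms (Ideal.span S) p
      rw [coeffMap_algHom_smul]
      exact smul_mem_vanishingForms _ (evalT_mem_span hS hf) _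
  cases p with
  | zero => exact hI
  | succ q =>
    rw [vanishingForms_succ]
    refine sup_le hI (Submodule.span_le.mpr ?_)
    rintro _ ⟨f, hf, η, rfl⟩
    show coeffMap evalT.toLinearMap (dWedge f η) ∈ vanishingForms (Ideal.span S) (q + 1)
    rw [coeffMap_evalT_dWedge]
    exact Submodule.add_mem _ (dWedge_mem_vanishingForms _ (evalT_mem_span hS hf) _)
      (smul_mem_vanishingForms _ (evalT_mem_span hS (pderiv_last_mem_span hS hf)) _)

/-- Hence `Π` preserves the forms vanishing on `V(I')`. [folklore] -/
theorem piOp_mem : ∀ {p : ℕ} {ω : PolyForm k (n + 1) p},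
    ω ∈ vanishingForms (Ideal.span S) p → piOp ω ∈ vanishingForms (Ideal.span S) p
  | 0, _, h => coeffMap_evalT_mem_vanishingForms hS h
  | _ + 1, _, h => Submodule.sub_mem _ (coeffMap_evalT_mem_vanishingForms hS h)
      (dWedge_mem_vanishingForms_right _ _
        (coeffMap_evalT_mem_vanishingForms hS (curryLeft_mem_vanishingForms hS h)))

section RatAlgebra

variable [Algebra ℚ k]

omit hS in
/-- `∫₀^t (g θ) = g ∫₀^t θ` for a `t`-free polynomial `g`. [folklore] -/
theorem coeffMap_intT_smul_of_tfree {g : P1} (hg : evalT g = g) (θ : PolyForm k (n + 1) p) :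
    coeffMap intT (g • θ) = g • coeffMap intT θ := by
  refine AlternatingMap.ext fun v => ?_
  simp only [coeffMap_apply, AlternatingMap.smul_apply, smul_eq_mul]
  rw [← hg]
  exact intT_evalT_mul g (θ v)

omit hS in
/-- `∫₀^t (dg ∧ η) = dg ∧ ∫₀^t η` for a `t`-free polynomial `g`. [folklore] -/
theorem coeffMap_intT_dWedge_of_tfree {g : P1} (hg : evalT g = g) (η : PolyForm k (n + 1) p) :
    coeffMap intT (dWedge g η) = dWedge g (coeffMap intT η) := by
  refine AlternatingMap.ext fun v => ?_
  simp only [coeffMap_apply, dWedge_apply, map_sum]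
  refine Finset.sum_congr rfl fun i _ => ?_
  have h1 : intT (dirDeriv (v i) g * η (i.removeNth v)) = dirDeriv (v i) g * intT (η (i.removeNth v)) := by
    rw [← evalT_dirDeriv_of_tfree hg]
    exact intT_evalT_mul _ _
  rcases neg_one_pow_eq_or (MvPolynomial (Fin (n + 1)) k) i with h | h
  · rw [h, one_mul, one_mul, h1]
  · rw [h, neg_one_mul, neg_one_mul, map_neg, h1]

/-- `∫₀^t (f θ)` vanishes on `V(I')` for `f ∈ I'`. [folklore] -/
theorem coeffMap_intT_smul_mem {f : P1} (hf : f ∈ Ideal.span S) (θ : PolyForm k (n + 1) p) :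
    coeffMap intT (f • θ) ∈ vanishingForms (Ideal.span S) p := by
  induction hf using Submodule.span_induction generalizing θ with
  | mem g hg =>
    rw [coeffMap_intT_smul_of_tfree (hS g hg)]
    exact smul_mem_vanishingForms _ (Ideal.subset_span hg) _
  | zero => rw [zero_smul, coeffMap_zero]; exact Submodule.zero_mem _
  | add x y _ _ hx hy => rw [add_smul, coeffMap_add_form]; exact Submodule.add_mem _ (hx θ) (hy θ)
  | smul a x _ hx => rw [smul_eq_mul, mul_comm, ← smul_smul]; exact hx (a • θ)

/-- `∫₀^t (df ∧ η)` vanishes on `V(I')` for `f ∈ I'`. [folklore] -/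
theorem coeffMap_intT_dWedge_mem {f : P1} (hf : f ∈ Ideal.span S) (η : PolyForm k (n + 1) p) :
    coeffMap intT (dWedge f η) ∈ vanishingForms (Ideal.span S) (p + 1) := by
  induction hf using Submodule.span_induction generalizing η with
  | mem g hg =>
    rw [coeffMap_intT_dWedge_of_tfree (hS g hg)]
    exact dWedge_mem_vanishingForms _ (Ideal.subset_span hg) _
  | zero => rw [dWedge_zero_fun, coeffMap_zero]; exact Submodule.zero_mem _
  | add x y _ _ hx hy => rw [dWedge_add_fun, coeffMap_add_form]; exact Submodule.add_mem _ (hx η) (hy η)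
  | smul a x hx' hx =>
    rw [smul_eq_mul, dWedge_mul, coeffMap_add_form, ← dWedge_smul_right]
    exact Submodule.add_mem _ (hx (a • η)) (coeffMap_intT_smul_mem hS hx' _)

/-- **Integration along the fibre preserves the forms vanishing on `V(I')`** for `I'` generated by
`t`-free polynomials. [folklore] -/
theorem coeffMap_intT_mem_vanishingForms {ω : PolyForm k (n + 1) p}
    (hω : ω ∈ vanishingForms (Ideal.span S) p) : coeffMap intT ω ∈ vanishingForms (Ideal.span S) p := by
  let N : Submodule P1 (PolyForm k (n + 1) p) :=
    { carrier := {ω | ∀ a : P1, coeffMap intT (a • ω) ∈ vanishingForms (Ideal.span S) p}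
      add_mem' := fun {x y} hx hy a => by
        rw [smul_add, coeffMap_add_form]
        exact Submodule.add_mem _ (hx a) (hy a)
      zero_mem' := fun a => by
        rw [smul_zero, coeffMap_zero]
        exact Submodule.zero_mem _
      smul_mem' := fun b ω hω a => by
        show coeffMap intT (a • b • ω) ∈ vanishingForms (Ideal.span S) p
        rw [smul_smul]
        exact hω (a * b) }
  suffices h : vanishingForms (Ideal.span S) p ≤ N by
    have h1 := h hω 1
    rwa [one_smul] at h1
  have hI : Ideal.span S • (⊤ : Submodule P1 (PolyForm k (n + 1) p)) ≤ N :=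
    Submodule.smul_le.mpr fun f hf θ _ a => by
      show coeffMap intT (a • f • θ) ∈ vanishingForms (Ideal.span S) p
      rw [smul_smul, mul_comm, ← smul_smul]
      exact coeffMap_intT_smul_mem hS hf _
  cases p with
  | zero => exact hI
  | succ q =>
    rw [vanishingForms_succ]
    refine sup_le hI (Submodule.span_le.mpr ?_)
    rintro _ ⟨f, hf, η, rfl⟩ a
    show coeffMap intT (a • dWedge f η) ∈ vanishingForms (Ideal.span S) (q + 1)
    rw [← dWedge_smul_right]
    exact coeffMap_intT_dWedge_mem hS hf _

/-- **The homotopy operator preserves the forms vanishing on `V(I')`** for `I'` generated by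
`t`-free polynomials. [cite: Hartshorne1975, Ch. II Prop. 7.1] -/
theorem hOp_mem {ω : PolyForm k (n + 1) (p + 1)} (hω : ω ∈ vanishingForms (Ideal.span S) (p + 1)) :
    hOp ω ∈ vanishingForms (Ideal.span S) p :=
  coeffMap_intT_mem_vanishingForms hS (curryLeft_mem_vanishingForms hS hω)

/-- **Every form closed on `V(I') = V(I) × 𝔸¹` is cohomologous to its projection onto the zero
section**: `ω − Πω` is exact on `V(I')` (namely `≡ d(hω)` modulo forms vanishing on `V(I')`).
[cite: Hartshorne1975, Ch. II Prop. 7.1] -/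
theorem isExactOn_sub_piOp : ∀ {p : ℕ} {ω : PolyForm k (n + 1) p},
    IsClosedOn (Ideal.span S) ω → IsExactOn (Ideal.span S) (ω - piOp ω)
  | 0, ω, h => by
    change ω - piOp ω ∈ vanishingForms (Ideal.span S) 0
    rw [← hOp_extDeriv_zero]
    exact hOp_mem hS h
  | p + 1, ω, h => ⟨hOp ω, by
      rw [← extDeriv_hOp_add, add_sub_cancel_left]
      exact hOp_mem hS h⟩

/-- `Π` maps forms closed on `V(I')` to forms closed on `V(I')`. [folklore] -/
theorem isClosedOn_piOp {ω : PolyForm k (n + 1) p} (h : IsClosedOn (Ideal.span S) ω) :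
    IsClosedOn (Ideal.span S) (piOp ω) := by
  unfold IsClosedOn at h ⊢
  rw [← piOp_extDeriv]
  exact piOp_mem hS h

/-- `Π` maps forms exact on `V(I')` to forms exact on `V(I')`. [folklore] -/
theorem isExactOn_piOp : ∀ {p : ℕ} {ω : PolyForm k (n + 1) p},
    IsExactOn (Ideal.span S) ω → IsExactOn (Ideal.span S) (piOp ω)
  | 0, _, h => piOp_mem hS h
  | _ + 1, _, ⟨η, hη⟩ => ⟨piOp η, by
      rw [← piOp_extDeriv, ← piOp_sub]
      exact piOp_mem hS hη⟩

end RatAlgebra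

end TFree

end ALine

end AffineDeRham

end Literature.AlgebraicGeometry.Motives

end
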